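import Mathlib.Analysis.SpecialFunctions.Pow.Real
import HarnessLib

/-!
# QUANT lane R8, T-DEC finite-layer half: BLOB-DEC(2), part I — the polynomial certificates (two heavy blobs, floor tied to a blob)

builds on p205010 (kernel theorem, internal audit signed; external expert review pending)

Support file (`--supports stmt-CriticalPhenomena-4575`), QUANT lane seat prim-quant-census-2 (gen 51); memos
`run/shared/lean/prim/quant/prim-quant-census-2-g50/DEC-TAMP-G50.md` §3.6–3.8 and
`run/shared/lean/prim/quant/prim-quant-census-2-g51/BLOB-DEC2-G51.md`.  Pure real algebra (no probability); theorems only,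
no sorries, standard axioms; written in the style of `…QuantIndepBlobOneLightCantelliAlg`.  Part II
(`…QuantBlobDecTwoAlg`) turns these certificates into the GREEDY-DEC inequalities of every class at every floor.

SETTING (ARCH-TREES-G49 §2.2 / DEC-TAMP-G50 §3.1, §3.7).  Two independent heavy blobs `(a, g₁ = u)` and `(b, g₂ = v)`, sizes
`0 < a < b`, floor `0 < y ≤ min(u, v)`, mean `T = a u + b v`; the law has atoms `0, a, b, a+b` with masses
`(1−u)(1−v), u(1−v), (1−u)v, uv`.  At an effective layer `j'` with `T/2 ≤ j' < a + b` the DEC(j') linear programme asks to pair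
every LOW atom (`2k < T`, `k ≤ j'`) with self-sufficient partners: the GIANT `a+b` at gate exactly `y` (one unit of low mass uses
`y/(1−y)` units of giant mass) or a MID atom `m ≤ j'`, `2m ≥ T` at its minimal credit gate
`γ = max(ρ, y² + (1−y)ρ)`, `ρ = (T − 2·lo)/(m − lo)` (credit `2lo + (m − lo)κ_y(γ) = T`; one unit of low mass uses `γ/(1−γ)` units of
mid mass).  GREEDY-DEC (DEC-TAMP-G50 §3.7): lows ride with the giant first, the residual low mass goes through the cheapest
(low, mid) pairs.  In class aB (`2a < T`, `b` a mid), sub-case 2 (atom `0` does not fit under the giant), the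
success of GREEDY is the sign of a margin `Φ(y)`; at the tied floors its cleared form is a polynomial:

* floor on the SMALL blob (`y = u ≤ v ≤ 1/2`, DEC-TAMP-G50 §3.8 (v), the sub-case left open there): LIGHT regime
  `N_L = Φ·(1−u)K(b−T) = A b² + B ab + C a²`, HEAVY regime `N_H = Φ·(a+b−T)(b−T) = A_H b² + B_H ab + C_H a²`; the Taylor expansions
  at the edges `bv = (2−u)a` (`2a = T`) and `(v−u)b = 2(1−u)a` (`ρ = u`) have coefficients `G, H, A`, resp. `G_L, H_L, A_H`, all
  `≥ 0` on the triangle `0 ≤ u ≤ v ≤ 1/2` — `NL_nonneg`, `NH_nonneg`;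
* floor on the BIG blob (`y = v ≤ u ≤ 1/2`, DEC-TAMP-G50 §3.8 (iv)): cleared margin `(1−v)·a·u·M`, `v·M = (bv − (2−u)a)·E + a·F`
  with `E, F ≥ 0` on `0 ≤ v ≤ u ≤ 1/2` — `M_nonneg`.

The seven triangle inequalities (`A`, `G`, `H`, `G_L`, `H_L`; `E`, `F`) are proved from their Bernstein (Pólya–Handelman)
certificates: each polynomial is a nonnegative rational combination of the products `(2u)^i (2(v−u))^j (1−2v)^k` (resp.
`(2v)^i (2(u−v))^j (1−2u)^k`), degrees 2–6, 6–25 coefficients, found and independently re-verified in exact rational arithmetic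
(`prim-quant-census-2-g51/code/certs_dump.py`, `cert2.py`: every identity re-checked on a unisolvent grid); here `linarith`
re-finds the combination from the listed products.  [this work]
-/

namespace Summit.CriticalPhenomena.PercolationContinuityZ3.Theorems

namespace Quant

namespace BlobDec2

/-! ### 1. Triangle inequalities, floor on the small blob (`0 ≤ u ≤ v ≤ 1/2`): Bernstein certificates -/

/-- `A = (v−u)·A₁ ≥ 0`: the leading coefficient of the light quadratic form (`A₁` has a degree-3 Bernstein certificate with 9
nonnegative coefficients). [this work] -/
theorem A_nonneg (u v : ℝ) (hu : 0 ≤ u) (huv : u ≤ v) (hv : v ≤ 1 / 2) :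
    0 ≤ u * v ^ 3 - 3 * u ^ 2 * v ^ 2 + 2 * u ^ 3 * v - v ^ 3 + u * v ^ 2 + u ^ 2 * v - u ^ 3 + v ^ 2 - u * v := by
  have h1 : (0 : ℝ) ≤ 2 * u := by linarith
  have h2 : (0 : ℝ) ≤ 2 * (v - u) := by linarith
  have h3 : (0 : ℝ) ≤ 1 - 2 * v := by linarith
  linarith [mul_nonneg (pow_nonneg h2 2) (pow_nonneg h3 2),
    mul_nonneg (pow_nonneg h2 3) (h3),
    pow_nonneg h2 4,
    mul_nonneg (mul_nonneg h1 (h2)) (pow_nonneg h3 2),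
    mul_nonneg (mul_nonneg h1 (pow_nonneg h2 2)) (h3),
    mul_nonneg h1 (pow_nonneg h2 3),
    mul_nonneg (mul_nonneg (pow_nonneg h1 2) (h2)) (h3),
    mul_nonneg (pow_nonneg h1 2) (pow_nonneg h2 2),
    mul_nonneg (pow_nonneg h1 3) (h2)]

/-- `G = v²·Q(t₀) ≥ 0`, the value of the light quadratic form at the edge `bv = (2−u)a` (degree-6 Bernstein certificate, 25
nonnegative coefficients). [this work] -/
theorem G_nonneg (u v : ℝ) (hu : 0 ≤ u) (huv : u ≤ v) (hv : v ≤ 1 / 2) :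
    0 ≤ 2 * u ^ 4 * v ^ 2 + 2 * u ^ 5 * v + 2 * u ^ 2 * v ^ 3 - 3 * u ^ 3 * v ^ 2 - 10 * u ^ 4 * v - u ^ 5 + 2 * u * v ^ 3
      - 3 * u ^ 2 * v ^ 2 + 11 * u ^ 3 * v + 4 * u ^ 4 - 2 * v ^ 3 - 5 * u * v ^ 2 + 3 * u ^ 2 * v - 4 * u ^ 3 + 4 * v ^ 2
      - 2 * u * v := by
  have h1 : (0 : ℝ) ≤ 2 * u := by linarith
  have h2 : (0 : ℝ) ≤ 2 * (v - u) := by linarith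
  have h3 : (0 : ℝ) ≤ 1 - 2 * v := by linarith
  linarith [mul_nonneg (pow_nonneg h2 2) (pow_nonneg h3 4),
    mul_nonneg (pow_nonneg h2 3) (pow_nonneg h3 3),
    mul_nonneg (pow_nonneg h2 4) (pow_nonneg h3 2),
    mul_nonneg (pow_nonneg h2 5) (h3),
    pow_nonneg h2 6,
    mul_nonneg (mul_nonneg h1 (h2)) (pow_nonneg h3 4),
    mul_nonneg (mul_nonneg h1 (pow_nonneg h2 2)) (pow_nonneg h3 3),
    mul_nonneg (mul_nonneg h1 (pow_nonneg h2 3)) (pow_nonneg h3 2),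
    mul_nonneg (mul_nonneg h1 (pow_nonneg h2 4)) (h3),
    mul_nonneg h1 (pow_nonneg h2 5),
    mul_nonneg (pow_nonneg h1 2) (pow_nonneg h3 4),
    mul_nonneg (mul_nonneg (pow_nonneg h1 2) (h2)) (pow_nonneg h3 3),
    mul_nonneg (mul_nonneg (pow_nonneg h1 2) (pow_nonneg h2 2)) (pow_nonneg h3 2),
    mul_nonneg (mul_nonneg (pow_nonneg h1 2) (pow_nonneg h2 3)) (h3),
    mul_nonneg (pow_nonneg h1 2) (pow_nonneg h2 4),
    mul_nonneg (pow_nonneg h1 3) (pow_nonneg h3 3),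
    mul_nonneg (mul_nonneg (pow_nonneg h1 3) (h2)) (pow_nonneg h3 2),
    mul_nonneg (mul_nonneg (pow_nonneg h1 3) (pow_nonneg h2 2)) (h3),
    mul_nonneg (pow_nonneg h1 3) (pow_nonneg h2 3),
    mul_nonneg (pow_nonneg h1 4) (pow_nonneg h3 2),
    mul_nonneg (mul_nonneg (pow_nonneg h1 4) (h2)) (h3),
    mul_nonneg (pow_nonneg h1 4) (pow_nonneg h2 2),
    mul_nonneg (pow_nonneg h1 5) (h3),
    mul_nonneg (pow_nonneg h1 5) (h2),
    pow_nonneg h1 6]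

/-- `H = v·Q'(t₀) ≥ 0`, the slope of the light quadratic form at the edge `bv = (2−u)a` (degree-5 Bernstein certificate, 18
nonnegative coefficients). [this work] -/
theorem H_nonneg (u v : ℝ) (hu : 0 ≤ u) (huv : u ≤ v) (hv : v ≤ 1 / 2) :
    0 ≤ u ^ 2 * v ^ 3 + u ^ 3 * v ^ 2 - 4 * u ^ 4 * v + 3 * u * v ^ 3 - 10 * u ^ 2 * v ^ 2 + 9 * u ^ 3 * v + 2 * u ^ 4
      - 3 * v ^ 3 + 4 * u ^ 2 * v - 4 * u ^ 3 + 4 * v ^ 2 - 3 * u * v := by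
  have h1 : (0 : ℝ) ≤ 2 * u := by linarith
  have h2 : (0 : ℝ) ≤ 2 * (v - u) := by linarith
  have h3 : (0 : ℝ) ≤ 1 - 2 * v := by linarith
  linarith [mul_nonneg (pow_nonneg h2 2) (pow_nonneg h3 3),
    mul_nonneg (pow_nonneg h2 3) (pow_nonneg h3 2),
    mul_nonneg (pow_nonneg h2 4) (h3),
    pow_nonneg h2 5,
    mul_nonneg (mul_nonneg h1 (h2)) (pow_nonneg h3 3),
    mul_nonneg (mul_nonneg h1 (pow_nonneg h2 2)) (pow_nonneg h3 2),
    mul_nonneg (mul_nonneg h1 (pow_nonneg h2 3)) (h3),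
    mul_nonneg h1 (pow_nonneg h2 4),
    mul_nonneg (pow_nonneg h1 2) (pow_nonneg h3 3),
    mul_nonneg (mul_nonneg (pow_nonneg h1 2) (h2)) (pow_nonneg h3 2),
    mul_nonneg (mul_nonneg (pow_nonneg h1 2) (pow_nonneg h2 2)) (h3),
    mul_nonneg (pow_nonneg h1 2) (pow_nonneg h2 3),
    mul_nonneg (pow_nonneg h1 3) (pow_nonneg h3 2),
    mul_nonneg (mul_nonneg (pow_nonneg h1 3) (h2)) (h3),
    mul_nonneg (pow_nonneg h1 3) (pow_nonneg h2 2),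
    mul_nonneg (pow_nonneg h1 4) (h3),
    mul_nonneg (pow_nonneg h1 4) (h2),
    pow_nonneg h1 5]

/-- `G_L = (v−u)²·R(t_L) ≥ 0`, the value of the heavy quadratic form at the edge `(v−u)b = 2(1−u)a` (degree-5 Bernstein
certificate, 14 nonnegative coefficients). [this work] -/
theorem GL_nonneg (u v : ℝ) (hu : 0 ≤ u) (huv : u ≤ v) (hv : v ≤ 1 / 2) :
    0 ≤ -(2 * u ^ 2 * v ^ 3) + 2 * u ^ 4 * v + 5 * u * v ^ 3 + 4 * u ^ 2 * v ^ 2 - 9 * u ^ 3 * v - 2 * v ^ 3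
      - 11 * u * v ^ 2 + 12 * u ^ 2 * v + u ^ 3 + 4 * v ^ 2 - 2 * u * v - 2 * u ^ 2 := by
  have h1 : (0 : ℝ) ≤ 2 * u := by linarith
  have h2 : (0 : ℝ) ≤ 2 * (v - u) := by linarith
  have h3 : (0 : ℝ) ≤ 1 - 2 * v := by linarith
  linarith [mul_nonneg (pow_nonneg h2 2) (pow_nonneg h3 3),
    mul_nonneg (pow_nonneg h2 3) (pow_nonneg h3 2),
    mul_nonneg (pow_nonneg h2 4) (h3),
    pow_nonneg h2 5,
    mul_nonneg (mul_nonneg h1 (h2)) (pow_nonneg h3 3),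
    mul_nonneg (mul_nonneg h1 (pow_nonneg h2 2)) (pow_nonneg h3 2),
    mul_nonneg (mul_nonneg h1 (pow_nonneg h2 3)) (h3),
    mul_nonneg h1 (pow_nonneg h2 4),
    mul_nonneg (mul_nonneg (pow_nonneg h1 2) (h2)) (pow_nonneg h3 2),
    mul_nonneg (mul_nonneg (pow_nonneg h1 2) (pow_nonneg h2 2)) (h3),
    mul_nonneg (pow_nonneg h1 2) (pow_nonneg h2 3),
    mul_nonneg (mul_nonneg (pow_nonneg h1 3) (h2)) (h3),
    mul_nonneg (pow_nonneg h1 3) (pow_nonneg h2 2),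
    mul_nonneg (pow_nonneg h1 4) (h2)]

/-- `H_L = (v−u)·R'(t_L) ≥ 0`, the slope of the heavy quadratic form at the edge `(v−u)b = 2(1−u)a` (degree-4 Bernstein
certificate, 9 nonnegative coefficients). [this work] -/
theorem HL_nonneg (u v : ℝ) (hu : 0 ≤ u) (huv : u ≤ v) (hv : v ≤ 1 / 2) :
    0 ≤ 3 * u * v ^ 3 - 2 * u ^ 2 * v ^ 2 - u ^ 3 * v - 3 * v ^ 3 - 3 * u * v ^ 2 + 6 * u ^ 2 * v + 4 * v ^ 2
      - 3 * u * v - u ^ 2 := by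
  have h1 : (0 : ℝ) ≤ 2 * u := by linarith
  have h2 : (0 : ℝ) ≤ 2 * (v - u) := by linarith
  have h3 : (0 : ℝ) ≤ 1 - 2 * v := by linarith
  linarith [mul_nonneg (pow_nonneg h2 2) (pow_nonneg h3 2),
    mul_nonneg (pow_nonneg h2 3) (h3),
    pow_nonneg h2 4,
    mul_nonneg (mul_nonneg h1 (h2)) (pow_nonneg h3 2),
    mul_nonneg (mul_nonneg h1 (pow_nonneg h2 2)) (h3),
    mul_nonneg h1 (pow_nonneg h2 3),
    mul_nonneg (mul_nonneg (pow_nonneg h1 2) (h2)) (h3),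
    mul_nonneg (pow_nonneg h1 2) (pow_nonneg h2 2),
    mul_nonneg (pow_nonneg h1 3) (h2)]

/-! ### 2. Triangle inequalities, floor on the big blob (`0 ≤ v ≤ u ≤ 1/2`) -/

/-- `E = 1 + u − 3v + uv + v² ≥ 0` on `0 ≤ v ≤ u ≤ 1/2` (the `b`-coefficient of `M`; degree-2 Bernstein certificate). [this work] -/
theorem E_nonneg (u v : ℝ) (hv : 0 ≤ v) (hvu : v ≤ u) (hu : u ≤ 1 / 2) :
    0 ≤ v ^ 2 + u * v - 3 * v + u + 1 := by
  have h1 : (0 : ℝ) ≤ 2 * v := by linarith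
  have h2 : (0 : ℝ) ≤ 2 * (u - v) := by linarith
  have h3 : (0 : ℝ) ≤ 1 - 2 * u := by linarith
  linarith [pow_nonneg h3 2, mul_nonneg h2 (h3), pow_nonneg h2 2, mul_nonneg h1 (h3), mul_nonneg h1 (h2), pow_nonneg h1 2]

/-- `F = (2−u)·E − v(1 − u − v + u² + uv) ≥ 0` on `0 ≤ v ≤ u ≤ 1/2` (DEC-TAMP-G50 §3.8 (iv); degree-3 Bernstein certificate,
10 nonnegative coefficients). [this work] -/
theorem F_nonneg (u v : ℝ) (hv : 0 ≤ v) (hvu : v ≤ u) (hu : u ≤ 1 / 2) :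
    0 ≤ -(2 * u * v ^ 2) - 2 * u ^ 2 * v + 3 * v ^ 2 + 6 * u * v - u ^ 2 - 7 * v + u + 2 := by
  have h1 : (0 : ℝ) ≤ 2 * v := by linarith
  have h2 : (0 : ℝ) ≤ 2 * (u - v) := by linarith
  have h3 : (0 : ℝ) ≤ 1 - 2 * u := by linarith
  linarith [pow_nonneg h3 3,
    mul_nonneg h2 (pow_nonneg h3 2),
    mul_nonneg (pow_nonneg h2 2) (h3),
    pow_nonneg h2 3,
    mul_nonneg h1 (pow_nonneg h3 2),
    mul_nonneg (mul_nonneg h1 (h2)) (h3),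
    mul_nonneg h1 (pow_nonneg h2 2),
    mul_nonneg (pow_nonneg h1 2) (h3),
    mul_nonneg (pow_nonneg h1 2) (h2),
    pow_nonneg h1 3]

/-! ### 3. The cleared margins are nonnegative -/

/-- LIGHT regime, floor on the small blob: the cleared margin `N_L = Φ·(1−u)K(b−T)` (written out as a polynomial in
`u, v, a, b`) is `≥ 0` whenever `0 ≤ u ≤ v ≤ 1/2`, `0 < v`, `0 ≤ a` and `bv ≥ (2−u)a` (i.e. `2a ≤ T`): Taylor expansion
`v²·N_L = G·a² + H·a·(bv − (2−u)a) + A·(bv − (2−u)a)²`. [this work] -/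
theorem NL_nonneg (u v a b : ℝ) (hu : 0 ≤ u) (huv : u ≤ v) (hv2 : v ≤ 1 / 2) (hv : 0 < v) (ha : 0 ≤ a)
    (hD : 0 ≤ b * v - (2 - u) * a) :
    0 ≤ (1 - u) * v * (1 - u) * (b * (1 + u - v) + a * (1 - 2 * u)) * (b - (a * u + b * v))
        - u * (1 - v) * (u ^ 2 * (b - a) + (1 - u) * ((a * u + b * v) - 2 * a)) * (b - (a * u + b * v))
        - (1 - u) * (1 - 2 * v) * (a * u + b * v) * (1 - u) * (b * (1 + u - v) + a * (1 - 2 * u)) := by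
  have hA := A_nonneg u v hu huv hv2
  have hG := G_nonneg u v hu huv hv2
  have hH := H_nonneg u v hu huv hv2
  have key : v ^ 2 * ((1 - u) * v * (1 - u) * (b * (1 + u - v) + a * (1 - 2 * u)) * (b - (a * u + b * v))
        - u * (1 - v) * (u ^ 2 * (b - a) + (1 - u) * ((a * u + b * v) - 2 * a)) * (b - (a * u + b * v))
        - (1 - u) * (1 - 2 * v) * (a * u + b * v) * (1 - u) * (b * (1 + u - v) + a * (1 - 2 * u)))
      = (2 * u ^ 4 * v ^ 2 + 2 * u ^ 5 * v + 2 * u ^ 2 * v ^ 3 - 3 * u ^ 3 * v ^ 2 - 10 * u ^ 4 * v - u ^ 5 + 2 * u * v ^ 3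
        - 3 * u ^ 2 * v ^ 2 + 11 * u ^ 3 * v + 4 * u ^ 4 - 2 * v ^ 3 - 5 * u * v ^ 2 + 3 * u ^ 2 * v - 4 * u ^ 3 + 4 * v ^ 2
        - 2 * u * v) * a ^ 2
      + (u ^ 2 * v ^ 3 + u ^ 3 * v ^ 2 - 4 * u ^ 4 * v + 3 * u * v ^ 3 - 10 * u ^ 2 * v ^ 2 + 9 * u ^ 3 * v + 2 * u ^ 4
        - 3 * v ^ 3 + 4 * u ^ 2 * v - 4 * u ^ 3 + 4 * v ^ 2 - 3 * u * v) * a * (b * v - (2 - u) * a)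
      + (u * v ^ 3 - 3 * u ^ 2 * v ^ 2 + 2 * u ^ 3 * v - v ^ 3 + u * v ^ 2 + u ^ 2 * v - u ^ 3 + v ^ 2 - u * v)
        * (b * v - (2 - u) * a) ^ 2 := by
    ring
  have hR : 0 ≤ v ^ 2 * ((1 - u) * v * (1 - u) * (b * (1 + u - v) + a * (1 - 2 * u)) * (b - (a * u + b * v))
        - u * (1 - v) * (u ^ 2 * (b - a) + (1 - u) * ((a * u + b * v) - 2 * a)) * (b - (a * u + b * v))
        - (1 - u) * (1 - 2 * v) * (a * u + b * v) * (1 - u) * (b * (1 + u - v) + a * (1 - 2 * u))) := by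
    rw [key]
    have h1 := mul_nonneg hG (sq_nonneg a)
    have h2 := mul_nonneg (mul_nonneg hH ha) hD
    have h3 := mul_nonneg hA (sq_nonneg (b * v - (2 - u) * a))
    linarith
  have hv2 : 0 < v ^ 2 := by positivity
  exact le_of_mul_le_mul_left (by rw [mul_zero]; exact hR) hv2

/-- HEAVY regime, floor on the small blob: the cleared margin `N_H = Φ·(a+b−T)(b−T)` is `≥ 0` whenever `0 ≤ u ≤ v ≤ 1/2`,
`u < 1`, `0 < a` and `(v−u)b ≥ 2(1−u)a` (i.e. `ρ ≥ u`): Taylor expansion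
`(v−u)²·N_H = G_L·a² + H_L·a·((v−u)b − 2(1−u)a) + A_H·((v−u)b − 2(1−u)a)²`, `A_H = v(1−v)(v−u)`. [this work] -/
theorem NH_nonneg (u v a b : ℝ) (hu : 0 ≤ u) (huv : u ≤ v) (hv2 : v ≤ 1 / 2) (hu1 : u < 1) (ha : 0 < a)
    (hD : 0 ≤ (v - u) * b - 2 * (1 - u) * a) :
    0 ≤ (1 - u) * v * (a + b - (a * u + b * v)) * (b - (a * u + b * v))
        - u * (1 - v) * ((a * u + b * v) - 2 * a) * (b - (a * u + b * v))
        - (1 - u) * (1 - 2 * v) * (a * u + b * v) * (a + b - (a * u + b * v)) := by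
  have hGL := GL_nonneg u v hu huv hv2
  have hHL := HL_nonneg u v hu huv hv2
  have hAH : 0 ≤ v * (1 - v) * (v - u) := mul_nonneg (mul_nonneg (by linarith) (by linarith)) (by linarith)
  -- the edge condition forces `u < v`
  have hvu : u < v := by
    refine lt_of_le_of_ne huv (fun heq => ?_)
    rw [← heq, sub_self, zero_mul, zero_sub] at hD
    have h2 : 0 < 2 * (1 - u) * a := by
      have : 0 < 1 - u := by linarith
      positivity
    linarith
  have key : (v - u) ^ 2 * ((1 - u) * v * (a + b - (a * u + b * v)) * (b - (a * u + b * v))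
        - u * (1 - v) * ((a * u + b * v) - 2 * a) * (b - (a * u + b * v))
        - (1 - u) * (1 - 2 * v) * (a * u + b * v) * (a + b - (a * u + b * v)))
      = (-(2 * u ^ 2 * v ^ 3) + 2 * u ^ 4 * v + 5 * u * v ^ 3 + 4 * u ^ 2 * v ^ 2 - 9 * u ^ 3 * v - 2 * v ^ 3
        - 11 * u * v ^ 2 + 12 * u ^ 2 * v + u ^ 3 + 4 * v ^ 2 - 2 * u * v - 2 * u ^ 2) * a ^ 2
      + (3 * u * v ^ 3 - 2 * u ^ 2 * v ^ 2 - u ^ 3 * v - 3 * v ^ 3 - 3 * u * v ^ 2 + 6 * u ^ 2 * v + 4 * v ^ 2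
        - 3 * u * v - u ^ 2) * a * ((v - u) * b - 2 * (1 - u) * a)
      + (v * (1 - v) * (v - u)) * ((v - u) * b - 2 * (1 - u) * a) ^ 2 := by
    ring
  have hR : 0 ≤ (v - u) ^ 2 * ((1 - u) * v * (a + b - (a * u + b * v)) * (b - (a * u + b * v))
        - u * (1 - v) * ((a * u + b * v) - 2 * a) * (b - (a * u + b * v))
        - (1 - u) * (1 - 2 * v) * (a * u + b * v) * (a + b - (a * u + b * v))) := by
    rw [key]
    have h1 := mul_nonneg hGL (sq_nonneg a)
    have h2 := mul_nonneg (mul_nonneg hHL ha.le) hD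
    have h3 := mul_nonneg hAH (sq_nonneg ((v - u) * b - 2 * (1 - u) * a))
    linarith
  have hpos : 0 < (v - u) ^ 2 := by
    have : 0 < v - u := by linarith
    positivity
  exact le_of_mul_le_mul_left (by rw [mul_zero]; exact hR) hpos

/-- Floor on the big blob: `M = b·E' − a·(1 − u − v + u² + uv) ≥ 0` whenever `0 < v ≤ u ≤ 1/2`, `0 ≤ a`, `bv ≥ (2−u)a`, via
`v·M = (bv − (2−u)a)·E + a·F` (DEC-TAMP-G50 §3.8 (iv), there with the strict conclusion). [this work] -/
theorem M_nonneg (u v a b : ℝ) (hv : 0 < v) (hvu : v ≤ u) (hu : u ≤ 1 / 2) (ha : 0 ≤ a) (hD : 0 ≤ b * v - (2 - u) * a) :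
    0 ≤ b * (1 + u - 3 * v + u * v + v ^ 2) - a * (1 - u - v + u ^ 2 + u * v) := by
  have hE := E_nonneg u v hv.le hvu hu
  have hF := F_nonneg u v hv.le hvu hu
  have key : v * (b * (1 + u - 3 * v + u * v + v ^ 2) - a * (1 - u - v + u ^ 2 + u * v))
      = (b * v - (2 - u) * a) * (v ^ 2 + u * v - 3 * v + u + 1)
        + a * (-(2 * u * v ^ 2) - 2 * u ^ 2 * v + 3 * v ^ 2 + 6 * u * v - u ^ 2 - 7 * v + u + 2) := by ring
  have hR : 0 ≤ v * (b * (1 + u - 3 * v + u * v + v ^ 2) - a * (1 - u - v + u ^ 2 + u * v)) := by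
    rw [key]
    have h1 := mul_nonneg hD hE
    have h2 := mul_nonneg ha hF
    linarith
  exact le_of_mul_le_mul_left (by rw [mul_zero]; exact hR) hv

/-! ### 4. The minimal credit gate `γ = max(ρ, y² + (1−y)ρ)` of a (low, mid) pair -/

/-- The minimal credit gate `γ = max(ρ, y² + (1−y)ρ)` equals the light form `y² + (1−y)ρ` when `ρ ≤ y` (`0 ≤ y`). [this work] -/
theorem gate_eq_light (y ρ : ℝ) (hy : 0 ≤ y) (h : ρ ≤ y) : max ρ (y ^ 2 + (1 - y) * ρ) = y ^ 2 + (1 - y) * ρ := by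
  apply max_eq_right
  nlinarith [mul_nonneg hy (sub_nonneg.2 h)]

/-- The minimal credit gate `γ = max(ρ, y² + (1−y)ρ)` equals the heavy form `ρ` when `y ≤ ρ` (`0 ≤ y`). [this work] -/
theorem gate_eq_heavy (y ρ : ℝ) (hy : 0 ≤ y) (h : y ≤ ρ) : max ρ (y ^ 2 + (1 - y) * ρ) = ρ := by
  apply max_eq_left
  nlinarith [mul_nonneg hy (sub_nonneg.2 h)]

/-- The minimal credit gate `max(ρ, y² + (1−y)ρ)` is non-decreasing in the floor `y > 0`. [this work] -/
theorem gate_mono (ρ y y' : ℝ) (hy : 0 < y) (hyy : y ≤ y') :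
    max ρ (y ^ 2 + (1 - y) * ρ) ≤ max ρ (y' ^ 2 + (1 - y') * ρ) := by
  rcases le_total ρ y with h | h
  · -- light at `y`: `y² + (1-y)ρ = ρ + y(y-ρ) ≤ ρ + y'(y'-ρ)`
    have h1 : y * (y - ρ) ≤ y' * (y' - ρ) := by
      have := mul_le_mul hyy (by linarith : y - ρ ≤ y' - ρ) (by linarith) (by linarith)
      linarith
    calc max ρ (y ^ 2 + (1 - y) * ρ) = y ^ 2 + (1 - y) * ρ := gate_eq_light y ρ hy.le h
      _ ≤ y' ^ 2 + (1 - y') * ρ := by nlinarith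
      _ ≤ max ρ (y' ^ 2 + (1 - y') * ρ) := le_max_right _ _
  · rw [gate_eq_heavy y ρ hy.le h]
    exact le_max_left _ _

/-- The credit rate `ρ = (T − 2a)/(b − a)` of the pair `(a, b)` is at most the big gate `v` (`⟺ a(u + v − 2) ≤ 0`). [this work] -/
theorem rho_le (u v a b T : ℝ) (hu1 : u ≤ 1) (hv1 : v ≤ 1) (ha : 0 ≤ a) (hab : a < b) (hT : T = a * u + b * v) :
    (T - 2 * a) / (b - a) ≤ v := by
  rw [div_le_iff₀ (by linarith), hT]; nlinarith [mul_nonneg ha (by linarith : (0 : ℝ) ≤ 2 - u - v)]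

end BlobDec2

end Quant

end Summit.CriticalPhenomena.PercolationContinuityZ3.Theorems
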